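import Summits.HodgeConjecture.HodgeConjecture.Theorems.Ring2WeilCoverageCMFieldIrrationalRows
import Summits.HodgeConjecture.HodgeConjecture.Theorems.Ring2WeilCoverageCMFieldNormWitnesses
import HarnessLib

/-!
# Weil-type components over quartic CM fields with NO RATIONAL DISCRIMINANT, V: the non-Galois field
# `ℚ(√-(3+√2))` — non-rational rows at the both-inert prime `103`, and the three «–» rows of §b03.5 ARE integer rows

research route conditional on HC_CM; not a corollary; Q11.4-sentence-2 already refuted in dim ≥ 3.
Cell `pub-hodge-ring2`, seat `ring2-b03` (gen 57); kernel certificates for the Weil-type family-coverage census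
`HOME/WEIL-FAMILY-COVERAGE.md` §b03.5 (operator priority5 2026-08-22T11:46:08Z). Companion of
`Ring2WeilCoverageCMFieldNormParity.lean` / `…IrrationalRows.lean`. For the `D₄` field `E = ℚ(√-(3+√2))`
(`R = S² + 6S + 7`, `F = ℚ(√2)`, `σ = −(3+√2)`, class number 2) the Galois argument «a rational `n` has a
`Gal(F/ℚ)`-stable `T`» does not apply (the conjugate of an inert place may be SPLIT in `E/F`), and indeed:

* §1 NON-RATIONAL rows exist, but only where BOTH places of `F` over a prime `ℓ` are inert in `E/F` — first at
  `ℓ = 103` (then `113`, …; none inside `S6`): `σ ≡ 35, 62 (mod 103)` are both non-squares, so the norm-parity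
  engine applies; instances `38 ∓ √2 = 41 + σ, 35 − σ` (norm `1442 = 2·7·103`): `[41 + σ] ≠ [c]`, `[35 − σ] ≠ [c]`
  for every `c ∈ ℚ^×` (`sqrtNegThreePlusSqrtTwo_irrational_rows`).
* §2 the CONVERSE certificate, generic: an integer norm witness `(A + Bσ)² − σ(C + Dσ)² = n·(u + vσ)` gives
  `[u + vσ] = [n]` (`mk_eq_mk_intCast_of_coords`; `[n]² = [1]` as squares are norms,
  `sq_mem_normUnitsSubgroup_cmField`).
* §3 the three rows `|T| = 2` inside `S6` of the `D₄` table of §b03.5 marked «least rational n: –» (search bound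
  `n ≤ 400`) ARE integer-indexed rows, as the `T`-sets of §b03.5 predict (`T(3) = {1,2}`, `T(17) = {2,3}`,
  `T(23) = {1,4}`, `T(41) = {2,6}`): `[27+13√2] = [1173] = [3·17·23]`, `[38−5√2] = [697] = [17·41]`,
  `[44+5√2] = [2829] = [3·23·41]`, by explicit witnesses (PARI `rnfisnorm`, kit job j207641; each verified here by
  two `norm_num` identities); §4 likewise for the three «–» rows `|T| = 4` with a tabulated representative:
  `[33+14√2] = [2091]`, `[39−17√2] = [943]`, `[50+15√2] = [615]` (kit job j207906). So inside `S6` EVERY row of the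
  `D₄` table has a rational member (`T(3), T(5), T(17), T(23), T(41)` span the even subsets of `S6`) — in contrast
  with the six Galois fields, where 100 tabulated rows inside `S6` have none (parts II–IV).

No named fact, no definition, no `sorry`; nothing about the Hodge conjecture is asserted.
References: [Deligne1982HodgeCycles] §4 p. 30 (1), Cor. 4.2, Lemma 4.6; [Landherr1936HermitianForms]. -/

noncomputable section

set_option linter.dupNamespace false

open Polynomial

namespace Summit.HodgeConjecture.HodgeConjecture.Ring2.WeilCoverageCM

open Literature.AlgebraicGeometry.Deligne1982
open Literature.AlgebraicGeometry.HodgeTheory (splitDiscriminantClassCM)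

/-! ### §1 Non-rational rows of `ℚ(√-(3+√2))` at the both-inert prime `ℓ = 103` -/

/-- **ℚ(√-(3+√2)), `ℓ = 103`** (two roots `σ ≡ 35, 62 (mod 103)`, non-squares: every place of `F` over `103` is
inert in `E/F`): every `δ = u + vσ ∈ ℤ[σ]` with `N_{F/ℚ}(δ) = u² - 6uv + 7v² = 103·w`, `103 ∤ w`, has
`[δ] ≠ [c]` in `F^×/Nm_{E/F}(E^×)` for EVERY `c ∈ ℚ^×`. [cite: Deligne1982HodgeCycles, §4 p. 30 (1) and Cor. 4.2] -/
theorem sqrtNegThreePlusSqrtTwo_mk_ne_mk_ratCast_of_norm_oneHundredThree {R : Polynomial ℤ} (hR : R = X ^ 2 + C 6 * X + C 7)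
    [Fact (Irreducible (realPolyQ R))] (u v w : ℤ) (hw : ¬ (103 : ℤ) ∣ w)
    (hN : u ^ 2 - 6 * u * v + 7 * v ^ 2 = 103 * w) (δ : (realField R)ˣ)
    (hδ : (δ : realField R) = AdjoinRoot.of (realPolyQ R) u + AdjoinRoot.of (realPolyQ R) v * AdjoinRoot.root (realPolyQ R))
    (c : ℚ) (γ : (realField R)ˣ) (hγ : (γ : realField R) = (c : realField R)) :
    (QuotientGroup.mk δ : cmNormResidueGroup R) ≠ QuotientGroup.mk γ := by
  haveI : Fact (Irreducible (cmPolyQ R)) := fact_irreducible_cmPolyQ_of_pos hR (by norm_num) (by norm_num) disc_not_sq_six_seven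
  exact mk_ne_mk_ratCast_of_normParity hR 103 (by norm_num) 35 62 (by norm_num) (by norm_num) (by decide) (by decide)
    (by norm_num) (by norm_num) u v 0 w (by exact_mod_cast hw) (by rw [hN]; push_cast; ring) δ hδ c γ hγ

/-- **ℚ(√-(3+√2)): rows of §b03.5 with NO RATIONAL REPRESENTATIVE, in the kernel** — for `R = X ^ 2 + C 6 * X + C 7` LITERALLY and
each listed `(u, v)` (convention `√2 = −(σ + 3), i.e. σ = −(3+√2)`; `(u,v)` = least representative `δ` of the row `T` of §b03.5 on `{1, σ}`
— times the square shown, if `δ ∉ ℤ[σ]` —, with its norm `N_{F/ℚ}`: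
  `(41,1)` = 38−√2 {(7,√2+3),(103,√2−38)}, N 1442;
  `(35,-1)` = 38+√2 {(7,√2+3),(103,√2+38)}, N 1442):
the class `[u + vσ]` differs from `[c]` for EVERY `c ∈ ℚ^×` — the component `W8.E.[u + vσ]` is none of the
integer-indexed rows `[n]` and not the split row. [cite: Deligne1982HodgeCycles, §4 p. 30 (1) and Cor. 4.2] -/
theorem sqrtNegThreePlusSqrtTwo_irrational_rows :
    haveI := fact_irreducible_realPolyQ_of_not_sq (R := X ^ 2 + C 6 * X + C 7) rfl disc_not_sq_six_seven
    ∀ uv ∈ [((41 : ℤ), (1 : ℤ)), (35, -1)],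
      ∀ δ : (realField (X ^ 2 + C 6 * X + C 7))ˣ,
        (δ : realField (X ^ 2 + C 6 * X + C 7)) = AdjoinRoot.of (realPolyQ (X ^ 2 + C 6 * X + C 7)) (uv.1 : ℚ)
            + AdjoinRoot.of (realPolyQ (X ^ 2 + C 6 * X + C 7)) (uv.2 : ℚ) * AdjoinRoot.root (realPolyQ (X ^ 2 + C 6 * X + C 7)) →
        ∀ (c : ℚ) (γ : (realField (X ^ 2 + C 6 * X + C 7))ˣ), (γ : realField (X ^ 2 + C 6 * X + C 7)) = (c : realField (X ^ 2 + C 6 * X + C 7)) →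
          (QuotientGroup.mk δ : cmNormResidueGroup (X ^ 2 + C 6 * X + C 7)) ≠ QuotientGroup.mk γ := by
  haveI := fact_irreducible_realPolyQ_of_not_sq (R := X ^ 2 + C 6 * X + C 7) rfl disc_not_sq_six_seven
  intro uv huv δ hδ c γ hγ
  obtain ⟨u, v⟩ := uv
  simp only [List.mem_cons, Prod.mk.injEq, List.not_mem_nil, or_false] at huv
  rcases huv with ⟨rfl, rfl⟩ | ⟨rfl, rfl⟩
  · exact sqrtNegThreePlusSqrtTwo_mk_ne_mk_ratCast_of_norm_oneHundredThree rfl 41 (1) (14) (by norm_num) (by norm_num) δ hδ c γ hγ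
  · exact sqrtNegThreePlusSqrtTwo_mk_ne_mk_ratCast_of_norm_oneHundredThree rfl 35 (-1) (14) (by norm_num) (by norm_num) δ hδ c γ hγ

/-! ### §2 The converse certificate: `[u + vσ] = [n]` from an integer norm witness -/

/-- **Rational representative from a norm witness.** On Deligne's carriers `F = ℚ[S]/(R)`, `E = ℚ[T]/(R(T²))`,
`R = S² + pS + q`: integers `A, B, C, D` with `(A + Bσ)² - σ(C + Dσ)² = n·(u + vσ)` — i.e. the two coordinate
identities `X(A,B,C,D) = nu`, `Y(A,B,C,D) = nv` of `NormDescent.normForm_coords` — give `[u + vσ] = [n]` in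
`F^×/Nm_{E/F}(E^×)` (`n·δ = Nm_{E/F}(x + yη)` is a norm, and `[n]² = [n²] = [1]` since squares of `F^×` are norms,
`sq_mem_normUnitsSubgroup_cmField`): the component `W8.E.[u + vσ]` IS the integer-indexed row `[n]`.
[cite: Deligne1982HodgeCycles, §4 p. 30 (1)] -/
theorem mk_eq_mk_intCast_of_coords {p q : ℤ} {R : Polynomial ℤ}
    (hR : R = X ^ 2 + C p * X + C q) [Fact (Irreducible (realPolyQ R))] [Fact (Irreducible (cmPolyQ R))]
    (u v n A B Cc D : ℤ)
    (hX : A ^ 2 - q * B ^ 2 + 2 * q * Cc * D - p * q * D ^ 2 = n * u)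
    (hY : 2 * A * B - p * B ^ 2 - Cc ^ 2 + 2 * p * Cc * D - (p ^ 2 - q) * D ^ 2 = n * v)
    (δ : (realField R)ˣ)
    (hδ : (δ : realField R) = AdjoinRoot.of (realPolyQ R) u + AdjoinRoot.of (realPolyQ R) v * AdjoinRoot.root (realPolyQ R))
    (γ : (realField R)ˣ) (hγ : (γ : realField R) = AdjoinRoot.of (realPolyQ R) n) :
    (QuotientGroup.mk δ : cmNormResidueGroup R) = QuotientGroup.mk γ := by
  have key := normForm_coords hR (A : ℚ) (B : ℚ) (Cc : ℚ) (D : ℚ)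
  have hXq : (A : ℚ) ^ 2 - q * (B : ℚ) ^ 2 + 2 * q * (Cc : ℚ) * D - p * q * (D : ℚ) ^ 2 = n * u := by
    exact_mod_cast hX
  have hYq : 2 * (A : ℚ) * B - p * (B : ℚ) ^ 2 - (Cc : ℚ) ^ 2 + 2 * p * (Cc : ℚ) * D
      - ((p : ℚ) ^ 2 - q) * (D : ℚ) ^ 2 = n * v := by
    exact_mod_cast hY
  rw [hXq, hYq, map_mul, map_mul] at key
  -- `[γ δ] = [1]`
  have h1 : (QuotientGroup.mk (γ * δ) : cmNormResidueGroup R) = splitDiscriminantClassCM R 2 := by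
    refine mk_eq_splitDiscriminantClassCM_two_of_normForm (γ * δ)
      (AdjoinRoot.of (realPolyQ R) A + AdjoinRoot.of (realPolyQ R) B * AdjoinRoot.root (realPolyQ R))
      (AdjoinRoot.of (realPolyQ R) Cc + AdjoinRoot.of (realPolyQ R) D * AdjoinRoot.root (realPolyQ R)) 1 one_ne_zero ?_
    rw [key, one_pow, mul_one, Units.val_mul, hγ, hδ]
    ring
  rw [splitDiscriminantClassCM_two_eq_one, QuotientGroup.mk_mul] at h1
  -- `[γ]² = 1`
  have h2 : (QuotientGroup.mk (γ ^ 2) : cmNormResidueGroup R) = 1 :=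
    (QuotientGroup.eq_one_iff _).2 (sq_mem_normUnitsSubgroup_cmField γ)
  rw [QuotientGroup.mk_pow, pow_two] at h2
  exact (eq_inv_of_mul_eq_one_right h1).trans (inv_eq_of_mul_eq_one_right h2)

/-! ### §3 `E = ℚ(√-(3+√2))`: the three rows `|T| = 2` inside `S6` of §b03.5 marked «least rational n: –» ARE
integer rows — `[27+13√2] = [3·17·23]`, `[38−5√2] = [17·41]`, `[44+5√2] = [3·23·41]` (the «–» was the search bound
`n ≤ 400`; witnesses found by PARI `rnfisnorm`, kit job j207641, verified here by `norm_num`) -/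

/-- **`[27 + 13√2] = [1173]` for `ℚ(√-(3+√2))`** (`√2 = −(σ+3)`: `27 + 13√2 = −12 − 13σ`; `1173 = 3·17·23`,
`T = {(17,√2+6),(23,√2−5)}` = row `{3,4}` of §b03.5; witness `x = −134 − 80σ`, `y = 105 + 16σ`:
`x² − σy² = 1173·(−12 − 13σ)`). [cite: Deligne1982HodgeCycles, §4 p. 30 (1)] -/
theorem sqrtNegThreePlusSqrtTwo_mk_row34_eq_mk_1173 {R : Polynomial ℤ} (hR : R = X ^ 2 + C 6 * X + C 7)
    [Fact (Irreducible (realPolyQ R))] (δ : (realField R)ˣ)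
    (hδ : (δ : realField R) = AdjoinRoot.of (realPolyQ R) (-12 : ℤ) + AdjoinRoot.of (realPolyQ R) (-13 : ℤ) * AdjoinRoot.root (realPolyQ R))
    (γ : (realField R)ˣ) (hγ : (γ : realField R) = AdjoinRoot.of (realPolyQ R) (1173 : ℤ)) :
    (QuotientGroup.mk δ : cmNormResidueGroup R) = QuotientGroup.mk γ := by
  haveI : Fact (Irreducible (cmPolyQ R)) := fact_irreducible_cmPolyQ_of_pos hR (by norm_num) (by norm_num) disc_not_sq_six_seven
  exact mk_eq_mk_intCast_of_coords hR (-12) (-13) 1173 (-134) (-80) 105 16 (by norm_num) (by norm_num) δ hδ γ hγ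

/-- **`[38 − 5√2] = [697]` for `ℚ(√-(3+√2))`** (`38 − 5√2 = 53 + 5σ`; `697 = 17·41`, row `{3,6} = {(17,√2+6),(41,√2+17)}`;
witness `x = −150 − σ`, `y = 115 + 24σ`). [cite: Deligne1982HodgeCycles, §4 p. 30 (1)] -/
theorem sqrtNegThreePlusSqrtTwo_mk_row36_eq_mk_697 {R : Polynomial ℤ} (hR : R = X ^ 2 + C 6 * X + C 7)
    [Fact (Irreducible (realPolyQ R))] (δ : (realField R)ˣ)
    (hδ : (δ : realField R) = AdjoinRoot.of (realPolyQ R) (53 : ℤ) + AdjoinRoot.of (realPolyQ R) (5 : ℤ) * AdjoinRoot.root (realPolyQ R))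
    (γ : (realField R)ˣ) (hγ : (γ : realField R) = AdjoinRoot.of (realPolyQ R) (697 : ℤ)) :
    (QuotientGroup.mk δ : cmNormResidueGroup R) = QuotientGroup.mk γ := by
  haveI : Fact (Irreducible (cmPolyQ R)) := fact_irreducible_cmPolyQ_of_pos hR (by norm_num) (by norm_num) disc_not_sq_six_seven
  exact mk_eq_mk_intCast_of_coords hR 53 5 697 (-150) (-1) 115 24 (by norm_num) (by norm_num) δ hδ γ hγ

/-- **`[44 + 5√2] = [2829]` for `ℚ(√-(3+√2))`** (`44 + 5√2 = 29 − 5σ`; `2829 = 3·23·41`, row `{4,6} = {(23,√2−5),(41,√2+17)}`;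
witness `x = −293 + 18σ`, `y = −61 − 22σ`). [cite: Deligne1982HodgeCycles, §4 p. 30 (1)] -/
theorem sqrtNegThreePlusSqrtTwo_mk_row46_eq_mk_2829 {R : Polynomial ℤ} (hR : R = X ^ 2 + C 6 * X + C 7)
    [Fact (Irreducible (realPolyQ R))] (δ : (realField R)ˣ)
    (hδ : (δ : realField R) = AdjoinRoot.of (realPolyQ R) (29 : ℤ) + AdjoinRoot.of (realPolyQ R) (-5 : ℤ) * AdjoinRoot.root (realPolyQ R))
    (γ : (realField R)ˣ) (hγ : (γ : realField R) = AdjoinRoot.of (realPolyQ R) (2829 : ℤ)) :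
    (QuotientGroup.mk δ : cmNormResidueGroup R) = QuotientGroup.mk γ := by
  haveI : Fact (Irreducible (cmPolyQ R)) := fact_irreducible_cmPolyQ_of_pos hR (by norm_num) (by norm_num) disc_not_sq_six_seven
  exact mk_eq_mk_intCast_of_coords hR 29 (-5) 2829 (-293) 18 (-61) (-22) (by norm_num) (by norm_num) δ hδ γ hγ

/-! ### §4 The same for the three rows `|T| = 4` inside `S6` with a tabulated representative: `[33+14√2] = [3·17·41]`,
`[39−17√2] = [23·41]`, `[50+15√2] = [3·5·41]` (kit job j207906) — so ALL six «–» rows of the `D₄` block of §b03.5 are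
integer rows -/

/-- **`[33 + 14√2] = [2091]` for `ℚ(√-(3+√2))`** (`33 + 14√2 = −9 − 14σ`; `2091 = 3·17·41`, row
`{1,2,3,6} = T(3) △ T(17) △ T(41)`; witness `x = 222 + 113σ`, `y = 248 + 76σ`). [cite: Deligne1982HodgeCycles, §4 p. 30 (1)] -/
theorem sqrtNegThreePlusSqrtTwo_mk_row1236_eq_mk_2091 {R : Polynomial ℤ} (hR : R = X ^ 2 + C 6 * X + C 7)
    [Fact (Irreducible (realPolyQ R))] (δ : (realField R)ˣ)
    (hδ : (δ : realField R) = AdjoinRoot.of (realPolyQ R) (-9 : ℤ) + AdjoinRoot.of (realPolyQ R) (-14 : ℤ) * AdjoinRoot.root (realPolyQ R))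
    (γ : (realField R)ˣ) (hγ : (γ : realField R) = AdjoinRoot.of (realPolyQ R) (2091 : ℤ)) :
    (QuotientGroup.mk δ : cmNormResidueGroup R) = QuotientGroup.mk γ := by
  haveI : Fact (Irreducible (cmPolyQ R)) := fact_irreducible_cmPolyQ_of_pos hR (by norm_num) (by norm_num) disc_not_sq_six_seven
  exact mk_eq_mk_intCast_of_coords hR (-9) (-14) 2091 222 113 248 76 (by norm_num) (by norm_num) δ hδ γ hγ

/-- **`[39 − 17√2] = [943]` for `ℚ(√-(3+√2))`** (`39 − 17√2 = 90 + 17σ`; `943 = 23·41`, row `{1,2,4,6} = T(23) △ T(41)`;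
witness `x = −122 − 44σ`, `y = −270 − 51σ`). [cite: Deligne1982HodgeCycles, §4 p. 30 (1)] -/
theorem sqrtNegThreePlusSqrtTwo_mk_row1246_eq_mk_943 {R : Polynomial ℤ} (hR : R = X ^ 2 + C 6 * X + C 7)
    [Fact (Irreducible (realPolyQ R))] (δ : (realField R)ˣ)
    (hδ : (δ : realField R) = AdjoinRoot.of (realPolyQ R) (90 : ℤ) + AdjoinRoot.of (realPolyQ R) (17 : ℤ) * AdjoinRoot.root (realPolyQ R))
    (γ : (realField R)ˣ) (hγ : (γ : realField R) = AdjoinRoot.of (realPolyQ R) (943 : ℤ)) :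
    (QuotientGroup.mk δ : cmNormResidueGroup R) = QuotientGroup.mk γ := by
  haveI : Fact (Irreducible (cmPolyQ R)) := fact_irreducible_cmPolyQ_of_pos hR (by norm_num) (by norm_num) disc_not_sq_six_seven
  exact mk_eq_mk_intCast_of_coords hR 90 17 943 (-122) (-44) (-270) (-51) (by norm_num) (by norm_num) δ hδ γ hγ

/-- **`[50 + 15√2] = [615]` for `ℚ(√-(3+√2))`** (`50 + 15√2 = 5 − 15σ`; `615 = 3·5·41`, row
`{1,2,5,6} = T(3) △ T(5) △ T(41)`; witness `x = 185 + 60σ`, `y = 70 − 5σ`). [cite: Deligne1982HodgeCycles, §4 p. 30 (1)] -/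
theorem sqrtNegThreePlusSqrtTwo_mk_row1256_eq_mk_615 {R : Polynomial ℤ} (hR : R = X ^ 2 + C 6 * X + C 7)
    [Fact (Irreducible (realPolyQ R))] (δ : (realField R)ˣ)
    (hδ : (δ : realField R) = AdjoinRoot.of (realPolyQ R) (5 : ℤ) + AdjoinRoot.of (realPolyQ R) (-15 : ℤ) * AdjoinRoot.root (realPolyQ R))
    (γ : (realField R)ˣ) (hγ : (γ : realField R) = AdjoinRoot.of (realPolyQ R) (615 : ℤ)) :
    (QuotientGroup.mk δ : cmNormResidueGroup R) = QuotientGroup.mk γ := by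
  haveI : Fact (Irreducible (cmPolyQ R)) := fact_irreducible_cmPolyQ_of_pos hR (by norm_num) (by norm_num) disc_not_sq_six_seven
  exact mk_eq_mk_intCast_of_coords hR 5 (-15) 615 185 60 70 (-5) (by norm_num) (by norm_num) δ hδ γ hγ

end Summit.HodgeConjecture.HodgeConjecture.Ring2.WeilCoverageCM

end
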